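import Summits.Ventures.Crystal3D.Theorems.StickyWulffConstantTextureLiminfTexShadowFaultedSameFrame
import HarnessLib

/-!
# T-F2 strip calculus (memo n3 §3 (L1)): per-STRIP caps for a same-frame pair of faulted plates — only mismatched strips pay

HONEST FRAMING. Venture `Summits/Ventures/Crystal3D` (cell `crystal3d-full`); helper for lane T's debt T-F2 = `stub_famFaulted`
(TexShadow v7, crux `TextureLiminfV5` stmt-Ventures-23912; owner 19481-p1, cf-p1 DECISIONS (lxxiii)/(lxxx): «(ii) strip calculus (L1):
GO now»).  Census-free bookkeeping on top of T's `charge_le_flux` (…ChargeFlux) and `…TexShadowFaultedSameFrame`; standard axioms;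
nothing about the wall inequality is claimed; F-C1 not moved.

For two Barlow plates presented with ONE frame `L` (any origins, any Hägg words; bilayer frames `A₁`, `A₂`; `θ`-cap
`κ := √(1 − ⟪L e₃, e₃⟫²)`), an admissible table vanishes on facing pairs with EQUAL linear lattices and is `≤ ½·κ` elsewhere
(`cap_of_admissible` + `frames_equal_or_coaxial_of_sameFrame`).  Hence any per-strip weights `κ₁, κ₂ ≥ 0` that DOMINATE THE
MISMATCHES (`κ ≤ κ₁ i + κ₂ j` whenever `A₁ i '' Λ₀ ≠ A₂ j '' Λ₀`) dominate the table strip by strip: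

* **`two_mul_tsum_charge_le_stripCaps_sameFrame`** — `2·Σ' c_ij·vol(S ∩ slab₁ i ∩ slab₂ j) ≤ Σ' κ₁ i·vol(S ∩ slab₁ i) + Σ' κ₂ j·vol(S ∩ slab₂ j)`
  for every finite-measure measurable `S` (the per-strip form every F_layer ledger consumes: strip fluxes on the right);
* **`two_mul_tsum_charge_le_mismatchStrips_of_const₂`** — the canonical instance «plate 2 has ONE bilayer lattice `Q`» (e.g. plate 2
  sign-constant): `κ₁ i = κ·𝟙[A₁ i '' Λ₀ ≠ Q]`, `κ₂ = 0`, i.e. ONLY PLATE 1's MISMATCHED STRIPS PAY, at rate `κ` per unit strip volume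
  (`Σ' c·vol ≤ ½·κ·vol(S ∩ ⋃ mismatched strips of plate 1)`; for hcp|fcc(F) about the hcp normal: the F′-strips, half the slice).
WHAT THIS IS NOT: no walker / flux count, no wall inequality; F-C1 not moved.
-/

noncomputable section

open scoped BigOperators InnerProductSpace ENNReal
open MeasureTheory

namespace Summit.Ventures.Crystal3D.Theorems

open Summit.Ventures.Crystal3D
open Literature.MathematicalPhysics.StatisticalMechanics (IsHaggSeq)
open Summit.Ventures.Crystal3D.Cruxes.TextureLiminf.TexShadow (E3 e₃ fccRef laySlab SharedAxis CoAx BilayerFramesAt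
  BilayerChargeAdmissible)

/-- **Per-strip caps for a same-frame pair.**  Weights `0 ≤ κ₁ i, κ₂ j ≤ B` with `√(1−⟪L e₃,e₃⟫²) ≤ κ₁ i + κ₂ j` on every MISMATCHED
facing pair dominate every admissible table strip by strip:
`2·Σ' c_ij·vol(S ∩ slab₁ i ∩ slab₂ j) ≤ Σ' κ₁ i·vol(S ∩ slab₁ i) + Σ' κ₂ j·vol(S ∩ slab₂ j)`. -/
theorem two_mul_tsum_charge_le_stripCaps_sameFrame {σ₁ σ₂ : ℤ → ℤ} (hσ₁ : IsHaggSeq σ₁) (hσ₂ : IsHaggSeq σ₂)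
    {L : E3 ≃ₗᵢ[ℝ] E3} {s₁ s₂ : E3} {A₁ A₂ : ℤ → (E3 ≃ₗᵢ[ℝ] E3)} {u₁ u₂ : ℤ → E3}
    (hfr₁ : BilayerFramesAt L s₁ σ₁ A₁ u₁) (hfr₂ : BilayerFramesAt L s₂ σ₂ A₂ u₂)
    {c : ℤ → ℤ → ℝ} {m : ℤ → ℤ → E3} (hadm : BilayerChargeAdmissible A₁ A₂ c m)
    (κ₁ κ₂ : ℤ → ℝ) (B : ℝ) (hκ₁ : ∀ i, 0 ≤ κ₁ i) (hκ₁B : ∀ i, κ₁ i ≤ B) (hκ₂ : ∀ j, 0 ≤ κ₂ j) (hκ₂B : ∀ j, κ₂ j ≤ B)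
    (hmis : ∀ i j, A₁ i '' fccRef ≠ A₂ j '' fccRef → Real.sqrt (1 - ⟪L e₃, e₃⟫_ℝ ^ 2) ≤ κ₁ i + κ₂ j)
    (S : Set E3) (hS : MeasurableSet S) (hSfin : volume S ≠ ⊤) :
    2 * ∑' ij : ℤ × ℤ, c ij.1 ij.2 * (volume (S ∩ laySlab L s₁ ij.1 ∩ laySlab L s₂ ij.2)).toReal ≤
      ∑' i : ℤ, κ₁ i * (volume (S ∩ laySlab L s₁ i)).toReal +
        ∑' j : ℤ, κ₂ j * (volume (S ∩ laySlab L s₂ j)).toReal := by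
  have hcap := cap_of_admissible hadm (Real.sqrt_nonneg _) (frames_equal_or_coaxial_of_sameFrame hσ₁ hσ₂ hfr₁ hfr₂)
  refine charge_le_flux L L s₁ s₂ κ₁ κ₂ c B hκ₁ hκ₁B hκ₂ hκ₂B hadm.1 (fun i j => ?_) S hS hSfin
  by_cases heq : A₁ i '' fccRef = A₂ j '' fccRef
  · rw [hadm.2.2.2 i j heq]
    have := hκ₁ i; have := hκ₂ j
    linarith
  · have h1 := hcap i j
    have h2 := hmis i j heq
    linarith

open scoped Classical in
/-- **Only plate 1's mismatched strips pay** when plate 2 carries ONE bilayer lattice `Q` (all `A₂ j '' Λ₀ = Q`, e.g. a sign-constant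
plate 2): `2·Σ' c_ij·vol(S ∩ slab₁ i ∩ slab₂ j) ≤ √(1−⟪L e₃,e₃⟫²)·Σ' 𝟙[A₁ i '' Λ₀ ≠ Q]·vol(S ∩ slab₁ i)`. -/
theorem two_mul_tsum_charge_le_mismatchStrips_of_const₂ {σ₁ σ₂ : ℤ → ℤ} (hσ₁ : IsHaggSeq σ₁) (hσ₂ : IsHaggSeq σ₂)
    {L : E3 ≃ₗᵢ[ℝ] E3} {s₁ s₂ : E3} {A₁ A₂ : ℤ → (E3 ≃ₗᵢ[ℝ] E3)} {u₁ u₂ : ℤ → E3}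
    (hfr₁ : BilayerFramesAt L s₁ σ₁ A₁ u₁) (hfr₂ : BilayerFramesAt L s₂ σ₂ A₂ u₂)
    {c : ℤ → ℤ → ℝ} {m : ℤ → ℤ → E3} (hadm : BilayerChargeAdmissible A₁ A₂ c m)
    {Q : Set E3} (hQ : ∀ j, A₂ j '' fccRef = Q)
    (S : Set E3) (hS : MeasurableSet S) (hSfin : volume S ≠ ⊤) :
    2 * ∑' ij : ℤ × ℤ, c ij.1 ij.2 * (volume (S ∩ laySlab L s₁ ij.1 ∩ laySlab L s₂ ij.2)).toReal ≤
      ∑' i : ℤ, (if A₁ i '' fccRef = Q then 0 else Real.sqrt (1 - ⟪L e₃, e₃⟫_ℝ ^ 2)) *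
        (volume (S ∩ laySlab L s₁ i)).toReal := by
  have hk0 : 0 ≤ Real.sqrt (1 - ⟪L e₃, e₃⟫_ℝ ^ 2) := Real.sqrt_nonneg _
  have h := two_mul_tsum_charge_le_stripCaps_sameFrame hσ₁ hσ₂ hfr₁ hfr₂ hadm
    (fun i => if A₁ i '' fccRef = Q then 0 else Real.sqrt (1 - ⟪L e₃, e₃⟫_ℝ ^ 2)) (fun _ => 0)
    (Real.sqrt (1 - ⟪L e₃, e₃⟫_ℝ ^ 2))
    (fun i => by by_cases h : A₁ i '' fccRef = Q <;> simp [h, hk0]) (fun i => by by_cases h : A₁ i '' fccRef = Q <;> simp [h, hk0])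
    (fun _ => le_rfl) (fun _ => hk0)
    (fun i j hne => by
      have hne' : ¬ A₁ i '' fccRef = Q := fun h' => hne (h'.trans (hQ j).symm)
      simp [hne'])
    S hS hSfin
  simpa using h

end Summit.Ventures.Crystal3D.Theorems

end
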